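import Literature.NumberTheory.LFunctions.WeilTwoPrimeOddMarginKBase
import Literature.NumberTheory.LFunctions.WeilTwoPrimeOddMarginKDataP9
import Literature.NumberTheory.LFunctions.WeilBlockRowsP
import HarnessLib

/-!
# Two-prime odd-margin certificate K: the materialized block agrees with `P_r`, rows 13–25

`WeilCert.checkPmRow` (row `k` of the claim `Pm_{kl} = P_r(2k+1, 2l+1)`) for certificate K, by `decide +kernel`. Pure proof file; nothing is asserted.
-/

noncomputable section

namespace Literature.NumberTheory.LFunctions

set_option maxHeartbeats 0 in
/-- Row 13 of the materialized block is row 13 of `P_r` (certificate K). [folklore] -/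
theorem checkPmRow1_13_weilCert23K : weilCert23KBase.checkPmRow weilCert23KNu weilCert23KPm 1 13 = true := by
  decide +kernel

set_option maxHeartbeats 0 in
/-- Row 14 of the materialized block is row 14 of `P_r` (certificate K). [folklore] -/
theorem checkPmRow1_14_weilCert23K : weilCert23KBase.checkPmRow weilCert23KNu weilCert23KPm 1 14 = true := by
  decide +kernel

set_option maxHeartbeats 0 in
/-- Row 15 of the materialized block is row 15 of `P_r` (certificate K). [folklore] -/
theorem checkPmRow1_15_weilCert23K : weilCert23KBase.checkPmRow weilCert23KNu weilCert23KPm 1 15 = true := by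
  decide +kernel

set_option maxHeartbeats 0 in
/-- Row 16 of the materialized block is row 16 of `P_r` (certificate K). [folklore] -/
theorem checkPmRow1_16_weilCert23K : weilCert23KBase.checkPmRow weilCert23KNu weilCert23KPm 1 16 = true := by
  decide +kernel

set_option maxHeartbeats 0 in
/-- Row 17 of the materialized block is row 17 of `P_r` (certificate K). [folklore] -/
theorem checkPmRow1_17_weilCert23K : weilCert23KBase.checkPmRow weilCert23KNu weilCert23KPm 1 17 = true := by
  decide +kernel

set_option maxHeartbeats 0 in
/-- Row 18 of the materialized block is row 18 of `P_r` (certificate K). [folklore] -/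
theorem checkPmRow1_18_weilCert23K : weilCert23KBase.checkPmRow weilCert23KNu weilCert23KPm 1 18 = true := by
  decide +kernel

set_option maxHeartbeats 0 in
/-- Row 19 of the materialized block is row 19 of `P_r` (certificate K). [folklore] -/
theorem checkPmRow1_19_weilCert23K : weilCert23KBase.checkPmRow weilCert23KNu weilCert23KPm 1 19 = true := by
  decide +kernel

set_option maxHeartbeats 0 in
/-- Row 20 of the materialized block is row 20 of `P_r` (certificate K). [folklore] -/
theorem checkPmRow1_20_weilCert23K : weilCert23KBase.checkPmRow weilCert23KNu weilCert23KPm 1 20 = true := by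
  decide +kernel

set_option maxHeartbeats 0 in
/-- Row 21 of the materialized block is row 21 of `P_r` (certificate K). [folklore] -/
theorem checkPmRow1_21_weilCert23K : weilCert23KBase.checkPmRow weilCert23KNu weilCert23KPm 1 21 = true := by
  decide +kernel

set_option maxHeartbeats 0 in
/-- Row 22 of the materialized block is row 22 of `P_r` (certificate K). [folklore] -/
theorem checkPmRow1_22_weilCert23K : weilCert23KBase.checkPmRow weilCert23KNu weilCert23KPm 1 22 = true := by
  decide +kernel

set_option maxHeartbeats 0 in
/-- Row 23 of the materialized block is row 23 of `P_r` (certificate K). [folklore] -/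
theorem checkPmRow1_23_weilCert23K : weilCert23KBase.checkPmRow weilCert23KNu weilCert23KPm 1 23 = true := by
  decide +kernel

set_option maxHeartbeats 0 in
/-- Row 24 of the materialized block is row 24 of `P_r` (certificate K). [folklore] -/
theorem checkPmRow1_24_weilCert23K : weilCert23KBase.checkPmRow weilCert23KNu weilCert23KPm 1 24 = true := by
  decide +kernel

set_option maxHeartbeats 0 in
/-- Row 25 of the materialized block is row 25 of `P_r` (certificate K). [folklore] -/
theorem checkPmRow1_25_weilCert23K : weilCert23KBase.checkPmRow weilCert23KNu weilCert23KPm 1 25 = true := by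
  decide +kernel


end Literature.NumberTheory.LFunctions
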